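import Mathlib
import HarnessLib

/-!
# Taylor data for the numerator split (line `janus-bands`, crux `ArrangementNormalForm`)

Pure algebra: every `p : MvPolynomial (Fin (b + 1)) ℚ` expands in powers of `y − ℓ(x')`
(`y` the last variable, `ℓ` a rational affine form in the first `b` variables) with polynomial
coefficients `qᵢ ∈ ℚ[x']`: `p(x', y) = ∑_{i<N} qᵢ(x') (y − ℓ(x'))^i` (`SeparatePos.exists_taylor`,
by induction on `p`). `separatePos_taylor` (registered sub-goal of `stub_separatePos`) is the
literal form consumed by `separatePos_split` (coordinates `z (Fin.castAdd k i)` of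
`z ∈ ℝ^{b+1+k}`).
-/

noncomputable section

open MvPolynomial

namespace Summit.KontsevichZagierPeriods.ArrangementNormalForm.JanusBands

namespace SeparatePos

variable {b : ℕ}

/-- Truncated sums do not see coefficients vanishing beyond the truncation. -/
theorem sum_range_extend {R : Type*} [AddCommMonoid R] (f : ℕ → R) {N N' : ℕ} (h : N ≤ N')
    (hf : ∀ i, N ≤ i → f i = 0) : ∑ i ∈ Finset.range N', f i = ∑ i ∈ Finset.range N, f i :=
  (Finset.sum_subset (Finset.range_subset_range.2 h) fun i _ hi =>
    hf i (not_lt.mp fun h' => hi (Finset.mem_range.2 h'))).symm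

/-- **Taylor expansion in the last variable at a polynomial centre.** For every
`p ∈ ℚ[x', y]` (`y = X (Fin.last b)`) and `c ∈ ℚ[x']` there are `N` and coefficients
`qᵢ ∈ ℚ[x']`, vanishing for `i ≥ N`, with `p(x', y) = ∑_{i<N} qᵢ(x') (y − c(x'))^i` at every
real point. -/
theorem exists_taylor (c : MvPolynomial (Fin b) ℚ) (p : MvPolynomial (Fin (b + 1)) ℚ) :
    ∃ (N : ℕ) (q : ℕ → MvPolynomial (Fin b) ℚ), (∀ i, N ≤ i → q i = 0) ∧
      ∀ (x : Fin b → ℝ) (y : ℝ), MvPolynomial.aeval (Fin.snoc x y : Fin (b + 1) → ℝ) p =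
        ∑ i ∈ Finset.range N, MvPolynomial.aeval x (q i) * (y - MvPolynomial.aeval x c) ^ i := by
  induction p using MvPolynomial.induction_on with
  | C r =>
    refine ⟨1, fun i => if i = 0 then C r else 0, fun i hi => if_neg (by omega), fun x y => ?_⟩
    simp
  | add p₁ p₂ ih₁ ih₂ =>
    obtain ⟨N₁, q₁, hq₁, h₁⟩ := ih₁
    obtain ⟨N₂, q₂, hq₂, h₂⟩ := ih₂
    refine ⟨N₁ + N₂, fun i => q₁ i + q₂ i, fun i hi => by
      beta_reduce
      rw [hq₁ i (by omega), hq₂ i (by omega), add_zero], fun x y => ?_⟩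
    rw [map_add, h₁, h₂,
      ← sum_range_extend (fun i => MvPolynomial.aeval x (q₁ i) * (y - MvPolynomial.aeval x c) ^ i)
        (Nat.le_add_right N₁ N₂) (fun i hi => by rw [hq₁ i hi, map_zero, zero_mul]),
      ← sum_range_extend (fun i => MvPolynomial.aeval x (q₂ i) * (y - MvPolynomial.aeval x c) ^ i)
        (Nat.le_add_left N₂ N₁) (fun i hi => by rw [hq₂ i hi, map_zero, zero_mul]),
      ← Finset.sum_add_distrib]
    refine Finset.sum_congr rfl fun i _ => ?_
    rw [map_add, add_mul]
  | mul_X p v ih =>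
    obtain ⟨N, q, hq, h⟩ := ih
    refine Fin.lastCases ?_ (fun j => ?_) v
    · -- multiplication by `y = (y - c) + c`
      refine ⟨N + 1, fun i => (if i = 0 then 0 else q (i - 1)) + c * q i, fun i hi => by
        beta_reduce
        rw [if_neg (by omega), hq (i - 1) (by omega), hq i (by omega), mul_zero, add_zero],
        fun x y => ?_⟩
      rw [map_mul, aeval_X, Fin.snoc_last, h]
      have hN : MvPolynomial.aeval x (q N) = 0 := by rw [hq N le_rfl, map_zero]
      simp only [map_add, map_mul, add_mul, Finset.sum_add_distrib]
      rw [Finset.sum_range_succ' (fun i => MvPolynomial.aeval x (if i = 0 then 0 else q (i - 1)) *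
          (y - MvPolynomial.aeval x c) ^ i), Finset.sum_range_succ (fun i =>
          MvPolynomial.aeval x c * MvPolynomial.aeval x (q i) * (y - MvPolynomial.aeval x c) ^ i),
        hN, Finset.sum_mul]
      simp only [if_pos, Nat.succ_ne_zero, if_false, Nat.add_sub_cancel, map_zero, zero_mul,
        add_zero, mul_zero, ← Finset.sum_add_distrib]
      refine Finset.sum_congr rfl fun i _ => ?_
      ring
    · refine ⟨N, fun i => q i * X j, fun i hi => by
        beta_reduce
        rw [hq i hi, zero_mul], fun x y => ?_⟩
      rw [map_mul, aeval_X, Fin.snoc_castSucc, h, Finset.sum_mul]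
      refine Finset.sum_congr rfl fun i _ => ?_
      rw [map_mul, aeval_X]
      ring

end SeparatePos

open SeparatePos in
/-- **Taylor data for `separatePos_split`** (registered sub-goal of `stub_separatePos`): every
numerator `p ∈ ℚ[x₀, …, x_b]` expands as `p = ∑_{i<N} qᵢ(x') (y − ℓ(x'))^i` in powers of the
distance to a rational affine centre `ℓ(x')`, `y = x_b`, with polynomial coefficients
`qᵢ ∈ ℚ[x']`; stated at the base coordinates `z (Fin.castAdd k i)` of `z ∈ ℝ^{b+1+k}`. -/
theorem separatePos_taylor (b k : ℕ) (p : MvPolynomial (Fin (b + 1)) ℚ) (ℓ : (Fin b → ℚ) × ℚ) : ∃ (N : ℕ) (q : ℕ → MvPolynomial (Fin b) ℚ), ∀ z : Fin (b + 1 + k) → ℝ, MvPolynomial.aeval (fun i => z (Fin.castAdd k i)) p = ∑ i ∈ Finset.range N, MvPolynomial.aeval (fun i => z (Fin.castAdd k (Fin.castSucc i))) (q i) * (z (Fin.castAdd k (Fin.last b)) - (∑ i, (ℓ.1 i : ℝ) * z (Fin.castAdd k (Fin.castSucc i)) + (ℓ.2 : ℝ))) ^ i := by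
  obtain ⟨N, q, -, h⟩ := exists_taylor (∑ i, C (ℓ.1 i) * X i + C ℓ.2) p
  refine ⟨N, q, fun z => ?_⟩
  have hz : (fun i => z (Fin.castAdd k i)) = (Fin.snoc (fun i => z (Fin.castAdd k (Fin.castSucc i)))
      (z (Fin.castAdd k (Fin.last b))) : Fin (b + 1) → ℝ) := by
    funext i
    refine Fin.lastCases ?_ (fun j => ?_) i
    · rw [Fin.snoc_last]
    · rw [Fin.snoc_castSucc]
  rw [hz, h]
  simp [map_sum]

end Summit.KontsevichZagierPeriods.ArrangementNormalForm.JanusBands
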